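import Mathlib
import Summits.RiemannHypothesis.RiemannHypothesis.Theorems.WeilFormatCDeflatedFarApprox
import Summits.RiemannHypothesis.RiemannHypothesis.Theorems.WeilFormatCDeflatedFarCoupling
import HarnessLib

/-!
# Format C, design C∞: the correction clause of the deflated certificate as a form in finitely many entries

Route context: Fourier–Galerkin / Schur-complement certificates of Weil positivity on a window ("format C";
cell memo `run/shared/lean/pub/rh-explicit/rh-explicit-weil-10/KERNEL-LEVER.md` §18; supporting
stmt-RiemannHypothesis-0098; seat rh-explicit-weil-10).

Third clause of the limit wrapper (`sum_range_mul_mul_nonneg_of_certificate_deflated_limit`, the rank-`r` correction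
`2Λ·(Eβ + η) − ΛᵀAΛ`).  At cut-off `P` it is a form in FOUR finite families of scalars — the profile Gram defect
`E_P(j,j') = Σ_{n∈[B,P)} V(n,j)V(n,j')`, the weighted profile Gram `A_P(j,j') = Σ_{m∈[B,P)} V(m,j)V(m,j')/d̂_m`, and the two
coefficient tables of `η_P(j) = Σ_{m∈[B,P)} V(m,j) g^P_m/d̂_m`, namely `ρ_P(j,i) = Σ_m V(m,j)M(i,m)/d̂_m` (block) and
`σ_P(j,j'') = Σ_m V(m,j)c^P(m,j'')/d̂_m` (profiles, `c^P(m,j'') = Σ_{n∈[B,P)} M(n,m)V(n,j'')`):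

* `sum_mul_sum_mul_eq` — `Σ_m f_m (Σ_i g_{m,i} z_i) = Σ_i (Σ_m f_m g_{m,i}) z_i`;
* `correction_eq_entries` — the wrapper's correction expression `=` the entry form (pure algebra);
* `abs_correctionForm_sub_le` — two entry families `δ`-close entrywise and `Σ_j |Λ_j| ≤ λ(Σ|x_i| + Σ|β_j|)` give
  `|T − T'| ≤ δ(4λ + λ²)(Σ|x_i| + Σ|β_j|)² ≤ 2δ(4λ + λ²)(B + r)(Σx² + Σβ²)`;
* `exists_correction_approx` — entrywise convergence of the four families ⟹ the wrapper's correction clause in the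
  eventual form `∀ ε > 0 ∃ P₀ ∀ P ≥ P₀ ∀ x β, |T_P(x,β) − T_∞(x,β)| ≤ ε(Σx² + Σβ²)` with `Cq := T_∞`.

Pure finite-dimensional real algebra plus `ε`-bookkeeping; standard axioms; nothing Weil-specific; no RH claim.
-/

-- `Summit.RiemannHypothesis.RiemannHypothesis.…` is the layout-mandated namespace (summit = problem name).
set_option linter.dupNamespace false

namespace Summit.RiemannHypothesis.RiemannHypothesis.Theorems.WeilFormatC

open Finset Filter Topology

/-! ## Algebra: the correction in entry form -/

/-- `Σ_{m∈s} f_m·(Σ_i g_{m,i} z_i) = Σ_i (Σ_{m∈s} f_m g_{m,i})·z_i`. -/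
theorem sum_mul_sum_mul_eq {ι : Type*} [Fintype ι] (s : Finset ℕ) (f : ℕ → ℝ) (g : ℕ → ι → ℝ) (z : ι → ℝ) :
    ∑ m ∈ s, f m * ∑ i, g m i * z i = ∑ i, (∑ m ∈ s, f m * g m i) * z i := by
  simp_rw [Finset.mul_sum, Finset.sum_mul]
  rw [Finset.sum_comm]
  exact Finset.sum_congr rfl fun i _ ↦ Finset.sum_congr rfl fun m _ ↦ by ring

/-- **The `η`-vector in entry form**: `Σ_{m∈[B,P)} V(m,j)·g^P_m/d̂_m = Σ_i ρ_P(j,i)x_i + Σ_{j''} σ_P(j,j'')β_{j''}`. -/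
theorem eta_eq_entries (M : ℕ → ℕ → ℝ) (B P : ℕ) {r : ℕ} (V : ℕ → Fin r → ℝ) (dhat : ℕ → ℝ)
    (x : Fin B → ℝ) (β : Fin r → ℝ) (j : Fin r) :
    ∑ m ∈ Ico B P, V m j * (∑ i : Fin B, M i m * x i + ∑ n ∈ Ico B P, M n m * ∑ j', V n j' * β j') / dhat m
      = ∑ i : Fin B, (∑ m ∈ Ico B P, V m j * M i m / dhat m) * x i
        + ∑ j'' : Fin r, (∑ m ∈ Ico B P, V m j * (∑ n ∈ Ico B P, M n m * V n j'') / dhat m) * β j'' := by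
  have hc : ∀ m, ∑ n ∈ Ico B P, M n m * ∑ j', V n j' * β j' = ∑ j'', (∑ n ∈ Ico B P, M n m * V n j'') * β j'' :=
    fun m ↦ sum_mul_sum_mul_eq _ _ _ _
  simp_rw [hc]
  have e : ∀ m, V m j * (∑ i : Fin B, M i m * x i + ∑ j'', (∑ n ∈ Ico B P, M n m * V n j'') * β j'') / dhat m
      = (V m j / dhat m) * ∑ i : Fin B, M i m * x i + (V m j / dhat m) * ∑ j'', (∑ n ∈ Ico B P, M n m * V n j'') * β j'' := by
    intro m; ring
  simp_rw [e]
  rw [Finset.sum_add_distrib, sum_mul_sum_mul_eq, sum_mul_sum_mul_eq]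
  congr 1
  · refine Finset.sum_congr rfl fun i _ ↦ ?_
    congr 1
    exact Finset.sum_congr rfl fun m _ ↦ by ring
  · refine Finset.sum_congr rfl fun j'' _ ↦ ?_
    congr 1
    exact Finset.sum_congr rfl fun m _ ↦ by ring

/-- **The wrapper's correction expression in entry form** (pure algebra): with `E_P, A_P, ρ_P, σ_P` as in the module
docstring, `2Σ_j Λ_j((β_j − Σ_{j'} E_P(j,j')β_{j'}) + η_P(j)) − Σ_{j,j'} Λ_jΛ_{j'}A_P(j,j')` equals the same expression with
`η_P(j)` replaced by `Σ_i ρ_P(j,i)x_i + Σ_{j''} σ_P(j,j'')β_{j''}`. -/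
theorem correction_eq_entries (M : ℕ → ℕ → ℝ) (B P : ℕ) {r : ℕ} (V : ℕ → Fin r → ℝ) (dhat : ℕ → ℝ)
    (Λv : Fin r → ℝ) (x : Fin B → ℝ) (β : Fin r → ℝ) :
    (2 * ∑ j : Fin r, Λv j *
        ((β j - ∑ j' : Fin r, (∑ n ∈ Ico B P, V n j * V n j') * β j')
          + ∑ m ∈ Ico B P, V m j * (∑ i : Fin B, M i m * x i + ∑ n ∈ Ico B P, M n m * ∑ j', V n j' * β j') / dhat m)
      - ∑ j : Fin r, ∑ j' : Fin r, Λv j * Λv j' * ∑ m ∈ Ico B P, V m j * V m j' / dhat m)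
    = 2 * ∑ j : Fin r, Λv j *
        ((β j - ∑ j' : Fin r, (∑ n ∈ Ico B P, V n j * V n j') * β j')
          + (∑ i : Fin B, (∑ m ∈ Ico B P, V m j * M i m / dhat m) * x i
            + ∑ j'' : Fin r, (∑ m ∈ Ico B P, V m j * (∑ n ∈ Ico B P, M n m * V n j'') / dhat m) * β j''))
      - ∑ j : Fin r, ∑ j' : Fin r, Λv j * Λv j' * ∑ m ∈ Ico B P, V m j * V m j' / dhat m := by
  simp_rw [eta_eq_entries]

/-! ## Approximation: two entry families `δ`-close -/

/-- **Entrywise closeness ⟹ closeness of the correction form.**  If `|E − E'|, |A − A'|, |ρ − ρ'|, |σ − σ'| ≤ δ` entrywise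
and `Σ_j |Λ_j| ≤ λ(Σ_i|x_i| + Σ_j|β_j|)`, then the two correction forms differ by at most
`δ(4λ + λ²)(Σ_i|x_i| + Σ_j|β_j|)²`. -/
theorem abs_correctionForm_sub_le {B r : ℕ} {E E' A A' σ σ' : Fin r → Fin r → ℝ} {ρ ρ' : Fin r → Fin B → ℝ}
    {δ lam : ℝ} (hδ : 0 ≤ δ)
    (hE : ∀ j j', |E j j' - E' j j'| ≤ δ) (hA : ∀ j j', |A j j' - A' j j'| ≤ δ)
    (hρ : ∀ j i, |ρ j i - ρ' j i| ≤ δ) (hσ : ∀ j j', |σ j j' - σ' j j'| ≤ δ)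
    (Λv : Fin r → ℝ) (x : Fin B → ℝ) (β : Fin r → ℝ)
    (hΛ : ∑ j, |Λv j| ≤ lam * (∑ i, |x i| + ∑ j, |β j|)) :
    |(2 * ∑ j, Λv j * ((β j - ∑ j', E j j' * β j') + (∑ i, ρ j i * x i + ∑ j'', σ j j'' * β j''))
        - ∑ j, ∑ j', Λv j * Λv j' * A j j')
      - (2 * ∑ j, Λv j * ((β j - ∑ j', E' j j' * β j') + (∑ i, ρ' j i * x i + ∑ j'', σ' j j'' * β j''))
        - ∑ j, ∑ j', Λv j * Λv j' * A' j j')|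
      ≤ δ * (4 * lam + lam ^ 2) * (∑ i, |x i| + ∑ j, |β j|) ^ 2 := by
  set X : ℝ := ∑ i, |x i| with hX
  set Y : ℝ := ∑ j, |β j| with hY
  set Lm : ℝ := ∑ j, |Λv j| with hLm
  have hX0 : 0 ≤ X := Finset.sum_nonneg fun i _ ↦ abs_nonneg _
  have hY0 : 0 ≤ Y := Finset.sum_nonneg fun j _ ↦ abs_nonneg _
  have hLm0 : 0 ≤ Lm := Finset.sum_nonneg fun j _ ↦ abs_nonneg _
  -- the difference, regrouped
  have hdiff : (2 * ∑ j, Λv j * ((β j - ∑ j', E j j' * β j') + (∑ i, ρ j i * x i + ∑ j'', σ j j'' * β j''))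
        - ∑ j, ∑ j', Λv j * Λv j' * A j j')
      - (2 * ∑ j, Λv j * ((β j - ∑ j', E' j j' * β j') + (∑ i, ρ' j i * x i + ∑ j'', σ' j j'' * β j''))
        - ∑ j, ∑ j', Λv j * Λv j' * A' j j')
      = 2 * ∑ j, Λv j * (-(∑ j', (E j j' - E' j j') * β j') + (∑ i, (ρ j i - ρ' j i) * x i
          + ∑ j'', (σ j j'' - σ' j j'') * β j''))
        - ∑ j, ∑ j', Λv j * Λv j' * (A j j' - A' j j') := by
    simp only [sub_mul, mul_sub, Finset.sum_sub_distrib, Finset.mul_sum, mul_add, mul_neg, Finset.sum_add_distrib,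
      Finset.sum_neg_distrib]
    ring
  rw [hdiff]
  -- inner vector bound: `|−Σ(E−E')β + Σ(ρ−ρ')x + Σ(σ−σ')β| ≤ δ(X + 2Y) ≤ 2δ(X+Y)`
  have hin : ∀ j, |-(∑ j', (E j j' - E' j j') * β j') + (∑ i, (ρ j i - ρ' j i) * x i
      + ∑ j'', (σ j j'' - σ' j j'') * β j'')| ≤ 2 * δ * (X + Y) := by
    intro j
    have h1 : |∑ j', (E j j' - E' j j') * β j'| ≤ δ * Y := by
      calc |∑ j', (E j j' - E' j j') * β j'| ≤ ∑ j', |(E j j' - E' j j') * β j'| := Finset.abs_sum_le_sum_abs _ _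
        _ ≤ ∑ j', δ * |β j'| := Finset.sum_le_sum fun j' _ ↦ by
            rw [abs_mul]; exact mul_le_mul_of_nonneg_right (hE j j') (abs_nonneg _)
        _ = δ * Y := by rw [hY, Finset.mul_sum]
    have h2 : |∑ i, (ρ j i - ρ' j i) * x i| ≤ δ * X := by
      calc |∑ i, (ρ j i - ρ' j i) * x i| ≤ ∑ i, |(ρ j i - ρ' j i) * x i| := Finset.abs_sum_le_sum_abs _ _
        _ ≤ ∑ i, δ * |x i| := Finset.sum_le_sum fun i _ ↦ by
            rw [abs_mul]; exact mul_le_mul_of_nonneg_right (hρ j i) (abs_nonneg _)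
        _ = δ * X := by rw [hX, Finset.mul_sum]
    have h3 : |∑ j'', (σ j j'' - σ' j j'') * β j''| ≤ δ * Y := by
      calc |∑ j'', (σ j j'' - σ' j j'') * β j''| ≤ ∑ j'', |(σ j j'' - σ' j j'') * β j''| :=
            Finset.abs_sum_le_sum_abs _ _
        _ ≤ ∑ j'', δ * |β j''| := Finset.sum_le_sum fun j'' _ ↦ by
            rw [abs_mul]; exact mul_le_mul_of_nonneg_right (hσ j j'') (abs_nonneg _)
        _ = δ * Y := by rw [hY, Finset.mul_sum]
    have t1 := abs_add_le (-(∑ j', (E j j' - E' j j') * β j')) ((∑ i, (ρ j i - ρ' j i) * x i)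
      + ∑ j'', (σ j j'' - σ' j j'') * β j'')
    have t2 := abs_add_le (∑ i, (ρ j i - ρ' j i) * x i) (∑ j'', (σ j j'' - σ' j j'') * β j'')
    rw [abs_neg] at t1
    nlinarith [mul_nonneg hδ hX0]
  -- first part
  have hp1 : |2 * ∑ j, Λv j * (-(∑ j', (E j j' - E' j j') * β j') + (∑ i, (ρ j i - ρ' j i) * x i
      + ∑ j'', (σ j j'' - σ' j j'') * β j''))| ≤ 2 * (Lm * (2 * δ * (X + Y))) := by
    rw [abs_mul, abs_of_pos (by norm_num : (0 : ℝ) < 2)]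
    refine mul_le_mul_of_nonneg_left ?_ (by norm_num)
    calc |∑ j, Λv j * (-(∑ j', (E j j' - E' j j') * β j') + (∑ i, (ρ j i - ρ' j i) * x i
          + ∑ j'', (σ j j'' - σ' j j'') * β j''))|
        ≤ ∑ j, |Λv j * (-(∑ j', (E j j' - E' j j') * β j') + (∑ i, (ρ j i - ρ' j i) * x i
          + ∑ j'', (σ j j'' - σ' j j'') * β j''))| := Finset.abs_sum_le_sum_abs _ _
      _ ≤ ∑ j, |Λv j| * (2 * δ * (X + Y)) := Finset.sum_le_sum fun j _ ↦ by
          rw [abs_mul]; exact mul_le_mul_of_nonneg_left (hin j) (abs_nonneg _)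
      _ = Lm * (2 * δ * (X + Y)) := by rw [hLm, Finset.sum_mul]
  -- second part
  have hp2 : |∑ j, ∑ j', Λv j * Λv j' * (A j j' - A' j j')| ≤ δ * Lm ^ 2 := by
    calc |∑ j, ∑ j', Λv j * Λv j' * (A j j' - A' j j')|
        ≤ ∑ j, |∑ j', Λv j * Λv j' * (A j j' - A' j j')| := Finset.abs_sum_le_sum_abs _ _
      _ ≤ ∑ j, ∑ j', |Λv j * Λv j' * (A j j' - A' j j')| :=
          Finset.sum_le_sum fun j _ ↦ Finset.abs_sum_le_sum_abs _ _
      _ ≤ ∑ j, ∑ j', |Λv j| * |Λv j'| * δ := Finset.sum_le_sum fun j _ ↦ Finset.sum_le_sum fun j' _ ↦ by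
          rw [abs_mul, abs_mul]
          exact mul_le_mul_of_nonneg_left (hA j j') (by positivity)
      _ = δ * Lm ^ 2 := by
          rw [hLm, sq, Finset.sum_mul_sum]
          simp_rw [Finset.mul_sum]
          exact Finset.sum_congr rfl fun j _ ↦ Finset.sum_congr rfl fun j' _ ↦ by ring
  have t := abs_sub (2 * ∑ j, Λv j * (-(∑ j', (E j j' - E' j j') * β j') + (∑ i, (ρ j i - ρ' j i) * x i
      + ∑ j'', (σ j j'' - σ' j j'') * β j''))) (∑ j, ∑ j', Λv j * Λv j' * (A j j' - A' j j'))
  have hLm' : Lm ≤ lam * (X + Y) := hΛ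
  have hXY : 0 ≤ X + Y := by positivity
  calc _ ≤ 2 * (Lm * (2 * δ * (X + Y))) + δ * Lm ^ 2 := t.trans (add_le_add hp1 hp2)
    _ ≤ 2 * ((lam * (X + Y)) * (2 * δ * (X + Y))) + δ * (lam * (X + Y)) ^ 2 := by
        have e1 : Lm * (2 * δ * (X + Y)) ≤ (lam * (X + Y)) * (2 * δ * (X + Y)) :=
          mul_le_mul_of_nonneg_right hLm' (by positivity)
        have e2 : Lm ^ 2 ≤ (lam * (X + Y)) ^ 2 := pow_le_pow_left₀ hLm0 hLm' 2
        nlinarith [mul_le_mul_of_nonneg_left e2 hδ]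
    _ = δ * (4 * lam + lam ^ 2) * (X + Y) ^ 2 := by ring

/-! ## The correction clause from entrywise convergence -/

/-- **Entrywise convergence ⟹ the correction clause (eventual form).**  Let the four entry families at cut-off `P`
converge entrywise, `E P → E∞`, `A P → A∞`, `ρ P → ρ∞`, `σ P → σ∞`, and let the free map satisfy
`Σ_j |Λ(x,β)_j| ≤ λ(Σ|x_i| + Σ|β_j|)`.  Then for every `ε > 0` there is `P₀` such that for all `P ≥ P₀` and all `(x, β)`
the correction form at `P` is within `ε(Σx² + Σβ²)` of the limit form. -/
theorem exists_correctionForm_approx {B r : ℕ} {E A σ : ℕ → Fin r → Fin r → ℝ} {ρ : ℕ → Fin r → Fin B → ℝ}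
    {Einf Ainf σinf : Fin r → Fin r → ℝ} {ρinf : Fin r → Fin B → ℝ}
    (hE : ∀ j j', Tendsto (fun P ↦ E P j j') atTop (𝓝 (Einf j j')))
    (hA : ∀ j j', Tendsto (fun P ↦ A P j j') atTop (𝓝 (Ainf j j')))
    (hρ : ∀ j i, Tendsto (fun P ↦ ρ P j i) atTop (𝓝 (ρinf j i)))
    (hσ : ∀ j j', Tendsto (fun P ↦ σ P j j') atTop (𝓝 (σinf j j')))
    (Λ : (Fin B → ℝ) → (Fin r → ℝ) → Fin r → ℝ) {lam : ℝ} (hlam : 0 ≤ lam)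
    (hΛ : ∀ (x : Fin B → ℝ) (β : Fin r → ℝ), ∑ j, |Λ x β j| ≤ lam * (∑ i, |x i| + ∑ j, |β j|))
    {ε : ℝ} (hε : 0 < ε) :
    ∃ P₀ : ℕ, ∀ P, P₀ ≤ P → ∀ (x : Fin B → ℝ) (β : Fin r → ℝ),
      |(2 * ∑ j, Λ x β j * ((β j - ∑ j', E P j j' * β j') + (∑ i, ρ P j i * x i + ∑ j'', σ P j j'' * β j''))
          - ∑ j, ∑ j', Λ x β j * Λ x β j' * A P j j')
        - (2 * ∑ j, Λ x β j * ((β j - ∑ j', Einf j j' * β j') + (∑ i, ρinf j i * x i + ∑ j'', σinf j j'' * β j''))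
          - ∑ j, ∑ j', Λ x β j * Λ x β j' * Ainf j j')|
        ≤ ε * (∑ i, x i ^ 2 + ∑ j, β j ^ 2) := by
  set δ : ℝ := ε / (2 * (4 * lam + lam ^ 2) * ((B : ℝ) + r) + 1) with hδdef
  have hden : 0 < 2 * (4 * lam + lam ^ 2) * ((B : ℝ) + r) + 1 := by positivity
  have hδ : 0 < δ := div_pos hε hden
  have hE' := eventually_forall_abs_sub_le (ι := Fin r × Fin r) (f := fun P p ↦ E P p.1 p.2) (g := fun p ↦ Einf p.1 p.2)
    (fun p ↦ hE p.1 p.2) hδ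
  have hA' := eventually_forall_abs_sub_le (ι := Fin r × Fin r) (f := fun P p ↦ A P p.1 p.2) (g := fun p ↦ Ainf p.1 p.2)
    (fun p ↦ hA p.1 p.2) hδ
  have hρ' := eventually_forall_abs_sub_le (ι := Fin r × Fin B) (f := fun P p ↦ ρ P p.1 p.2) (g := fun p ↦ ρinf p.1 p.2)
    (fun p ↦ hρ p.1 p.2) hδ
  have hσ' := eventually_forall_abs_sub_le (ι := Fin r × Fin r) (f := fun P p ↦ σ P p.1 p.2) (g := fun p ↦ σinf p.1 p.2)
    (fun p ↦ hσ p.1 p.2) hδ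
  obtain ⟨P₀, hP₀⟩ := eventually_atTop.1 (((hE'.and hA').and hρ').and hσ')
  refine ⟨P₀, fun P hP x β ↦ ?_⟩
  obtain ⟨⟨⟨h1, h2⟩, h3⟩, h4⟩ := hP₀ P hP
  have key := abs_correctionForm_sub_le (E := E P) (E' := Einf) (A := A P) (A' := Ainf) (ρ := ρ P) (ρ' := ρinf)
    (σ := σ P) (σ' := σinf) hδ.le (fun j j' ↦ h1 (j, j')) (fun j j' ↦ h2 (j, j')) (fun j i ↦ h3 (j, i))
    (fun j j' ↦ h4 (j, j')) (Λ x β) x β (hΛ x β)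
  refine key.trans ?_
  have hsq := sq_l1_le x β
  have hz : 0 ≤ ∑ i, x i ^ 2 + ∑ j, β j ^ 2 := by positivity
  have hc : 0 ≤ δ * (4 * lam + lam ^ 2) := by positivity
  calc δ * (4 * lam + lam ^ 2) * (∑ i, |x i| + ∑ j, |β j|) ^ 2
      ≤ δ * (4 * lam + lam ^ 2) * (2 * ((B : ℝ) + r) * (∑ i, x i ^ 2 + ∑ j, β j ^ 2)) :=
        mul_le_mul_of_nonneg_left hsq hc
    _ = (δ * (2 * (4 * lam + lam ^ 2) * ((B : ℝ) + r))) * (∑ i, x i ^ 2 + ∑ j, β j ^ 2) := by ring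
    _ ≤ ε * (∑ i, x i ^ 2 + ∑ j, β j ^ 2) := by
        refine mul_le_mul_of_nonneg_right ?_ hz
        rw [hδdef, div_mul_eq_mul_div, div_le_iff₀ hden]
        nlinarith [hε.le]

/-- **The wrapper's correction clause from entrywise convergence.**  With the entry families of the module docstring
(`E_P`, `A_P`, `ρ_P`, `σ_P` — finite sums in `M`, `V`, `d̂`) converging entrywise to `E∞`, `A∞`, `ρ∞`, `σ∞`, and
`Cq(x,β) := 2Σ_j Λ_j((β_j − Σ E∞β) + (Σ ρ∞x + Σ σ∞β)) − ΣΣ Λ_jΛ_{j'}A∞(j,j')`, the correction clause of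
`sum_range_mul_mul_nonneg_of_certificate_deflated_limit` holds eventually in `P`. -/
theorem exists_correction_approx (M : ℕ → ℕ → ℝ) (B : ℕ) {r : ℕ} (V : ℕ → Fin r → ℝ) (dhat : ℕ → ℝ)
    {Einf Ainf σinf : Fin r → Fin r → ℝ} {ρinf : Fin r → Fin B → ℝ}
    (hE : ∀ j j', Tendsto (fun P ↦ ∑ n ∈ Ico B P, V n j * V n j') atTop (𝓝 (Einf j j')))
    (hA : ∀ j j', Tendsto (fun P ↦ ∑ m ∈ Ico B P, V m j * V m j' / dhat m) atTop (𝓝 (Ainf j j')))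
    (hρ : ∀ (j : Fin r) (i : Fin B), Tendsto (fun P ↦ ∑ m ∈ Ico B P, V m j * M i m / dhat m) atTop (𝓝 (ρinf j i)))
    (hσ : ∀ j j'', Tendsto (fun P ↦ ∑ m ∈ Ico B P, V m j * (∑ n ∈ Ico B P, M n m * V n j'') / dhat m) atTop
      (𝓝 (σinf j j'')))
    (Λ : (Fin B → ℝ) → (Fin r → ℝ) → Fin r → ℝ) {lam : ℝ} (hlam : 0 ≤ lam)
    (hΛ : ∀ (x : Fin B → ℝ) (β : Fin r → ℝ), ∑ j, |Λ x β j| ≤ lam * (∑ i, |x i| + ∑ j, |β j|))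
    {ε : ℝ} (hε : 0 < ε) :
    ∃ P₀ : ℕ, ∀ P, P₀ ≤ P → ∀ (x : Fin B → ℝ) (β : Fin r → ℝ),
      |(2 * ∑ j : Fin r, Λ x β j *
          ((β j - ∑ j' : Fin r, (∑ n ∈ Ico B P, V n j * V n j') * β j')
            + ∑ m ∈ Ico B P, V m j * (∑ i : Fin B, M i m * x i + ∑ n ∈ Ico B P, M n m * ∑ j, V n j * β j) / dhat m)
        - ∑ j : Fin r, ∑ j' : Fin r, Λ x β j * Λ x β j' * ∑ m ∈ Ico B P, V m j * V m j' / dhat m)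
        - (2 * ∑ j, Λ x β j * ((β j - ∑ j', Einf j j' * β j') + (∑ i, ρinf j i * x i + ∑ j'', σinf j j'' * β j''))
          - ∑ j, ∑ j', Λ x β j * Λ x β j' * Ainf j j')|
        ≤ ε * (∑ i, x i ^ 2 + ∑ j, β j ^ 2) := by
  obtain ⟨P₀, hP₀⟩ := exists_correctionForm_approx (E := fun P j j' ↦ ∑ n ∈ Ico B P, V n j * V n j')
    (A := fun P j j' ↦ ∑ m ∈ Ico B P, V m j * V m j' / dhat m)
    (ρ := fun P j i ↦ ∑ m ∈ Ico B P, V m j * M i m / dhat m)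
    (σ := fun P j j'' ↦ ∑ m ∈ Ico B P, V m j * (∑ n ∈ Ico B P, M n m * V n j'') / dhat m)
    hE hA hρ hσ Λ hlam hΛ hε
  refine ⟨P₀, fun P hP x β ↦ ?_⟩
  rw [correction_eq_entries M B P V dhat (Λ x β) x β]
  exact hP₀ P hP x β

end Summit.RiemannHypothesis.RiemannHypothesis.Theorems.WeilFormatC
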